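import Literature.Analysis.FluidPDE.KNSSRegularityDecompositionHolds
import Literature.Analysis.FluidPDE.KNSSWeakDriftMildProofs
import Literature.Analysis.FluidPDE.KNSSRegularityGalileanProofs
import Literature.Analysis.FluidPDE.KNSSRegularityGluing
import Literature.Analysis.FluidPDE.KNSSMildDecayHorizontal
import Literature.Analysis.FluidPDE.AncientMildWeak
import HarnessLib

/-!
# Route DirectionEnergy, item `UntwistedAncientLiouville` — I: an Oseen-mild representative on windows

Helper file for item stmt-NavierStokesRegularity-2893 (`DirectionEnergy.UntwistedAncientLiouville`).

**The class bridge.** The item is stated for bounded ancient mild solutions of Navier–Stokes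
(`ν = 1`) in the tree's duality form (`IsBoundedAncientMildSolution 1 v`), which contains the
parasitic drifts `b(t)` (KNSS 2009, §1 p. 3) and therefore carries no Oseen integral equation.
For a jointly continuous member `v` and a window base `a < 0` we produce a co-moving
representative `W` on the window `(0, −a)` (time shifted by `a`) which IS a bounded solution of
the Oseen integral equation restarted at every time, is smooth in space, jointly measurable,
and differs from `v` at EVERY time of the window by a Galilean change of frame:
`v(τ + a, x) − v(τ + a, y) = W(τ, x − B τ) − W(τ, y − B τ)`.

Construction (all ingredients are theorems of the tree): `v` is a bounded weak solution
(`IsBoundedAncientMildSolution.isBoundedWeakNSSolutionOn`); on the window, KNSS's Lemma 3.1 in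
drift-mild form (`KNSS2009_weak_driftMild_holds`) writes `v(· + a) = U + β` a.e. with `(U, β)`
drift-mild, §4 (`KNSS2009_driftMild_regularity_holds`) makes `U` smooth with time-Lipschitz
gradients — which upgrades the a.e. identity to every time (continuity in `t` of both sides) —,
and the Galilean covariance of the drift-mild class (`IsKNSSDriftMild.galileanCovariance_R3`)
with the drift bridge (`driftDuhamel_eq_oseenDuhamel_drift`) turns `W = galileanShift U β` into a
zero-drift, i.e. Oseen-mild, field.

## References

* G. Koch, N. Nadirashvili, G. Seregin, V. Šverák, Acta Math. 203 (2009) 83–105 =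
  arXiv:0709.3599: §1 p. 3 (parasitic solutions, Galilean frames), Lemma 3.1 (p. 7), §4 (p. 8).
  [KochNadirashviliSereginSverak2009]
-/

set_option linter.dupNamespace false

noncomputable section

open MeasureTheory Set Function Filter Module
open scoped RealInnerProductSpace ContDiff

namespace Summit.NavierStokesRegularity.NavierStokesRegularity.Theorems

namespace UntwistedAncient

open Literature.Analysis Literature.Analysis.FluidPDE

/-- **From a.e. times to every time on a window.** If `u(τ) = U(τ) + β(τ)` a.e. in `x` for
a.e. `τ ∈ (0, T)`, the time lines `τ ↦ u τ x` are continuous on `(0, T)`, the slices `u τ`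
are continuous, and `U` has smooth slices whose gradients are Lipschitz in `τ` on every
`(δ, T)`, then `U τ x − U τ y = u τ x − u τ y` for EVERY `τ ∈ (0, T)` (window version of
`repr_sub_eq_sub_of_ae`). [cite: KochNadirashviliSereginSverak2009, Lemma 3.1 (arXiv p. 7) and §4 (p. 8)] -/
theorem repr_sub_eq_sub_of_ae_window
    {u U : ℝ → EuclideanSpace ℝ (Fin 3) → EuclideanSpace ℝ (Fin 3)}
    {β : ℝ → EuclideanSpace ℝ (Fin 3)} {T : ℝ} {L : ℕ → ℝ → ℝ}
    (hline : ∀ x, ContinuousOn (fun τ => u τ x) (Ioo 0 T))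
    (hslice : ∀ τ ∈ Ioo 0 T, Continuous (u τ))
    (hae : ∀ᵐ τ ∂((volume : Measure ℝ).restrict (Ioo 0 T)), u τ =ᵐ[volume] fun x => U τ x + β τ)
    (hsmooth : ∀ τ ∈ Ioo 0 T, ContDiff ℝ ∞ (U τ))
    (hlip : ∀ δ : ℝ, 0 < δ → ∀ k : ℕ, ∀ s ∈ Ioo δ T, ∀ t ∈ Ioo δ T, ∀ x,
      ‖iteratedFDeriv ℝ k (U t) x - iteratedFDeriv ℝ k (U s) x‖ ≤ L k δ * |t - s|) :
    ∀ τ ∈ Ioo 0 T, ∀ x y : EuclideanSpace ℝ (Fin 3), U τ x - U τ y = u τ x - u τ y := by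
  -- at a.e. `τ`, everywhere in `x`
  have hgood : ∀ᵐ τ ∂((volume : Measure ℝ).restrict (Ioo 0 T)), ∀ x y : EuclideanSpace ℝ (Fin 3),
      (U τ x - U τ y) - (u τ x - u τ y) = 0 := by
    filter_upwards [hae, ae_restrict_mem measurableSet_Ioo] with τ hτ hτI
    have hc : Continuous fun x => U τ x + β τ := (hsmooth τ hτI).continuous.add continuous_const
    have e := Measure.eq_of_ae_eq hτ (hslice τ hτI) hc
    intro x y
    rw [congr_fun e x, congr_fun e y]
    abel
  intro τ hτ x y
  -- work on the sub-window `(δ, T)`, `δ = τ/2`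
  set δ : ℝ := τ / 2 with hδ
  have hδ0 : 0 < δ := by rw [hδ]; linarith [hτ.1]
  have hτJ : τ ∈ Ioo δ T := ⟨by rw [hδ]; linarith [hτ.1], hτ.2⟩
  have hJI : Ioo δ T ⊆ Ioo 0 T := Ioo_subset_Ioo_left hδ0.le
  -- continuity in `τ` of both sides on `(δ, T)`
  have hU : ContinuousOn (fun s => U s x - U s y) (Ioo δ T) := by
    refine continuousOn_of_norm_sub_le_mul (L := L 1 δ * ‖x - y‖) fun s hs s' hs' => ?_
    have hd : Differentiable ℝ (U s' - U s) :=
      ((hsmooth s' (hJI hs')).sub (hsmooth s (hJI hs))).differentiable (by simp)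
    have hbound : ∀ z, ‖fderiv ℝ (U s' - U s) z‖ ≤ L 1 δ * |s' - s| := fun z => by
      have e1 : ‖fderiv ℝ (U s' - U s) z‖ = ‖iteratedFDeriv ℝ 1 (U s' - U s) z‖ := by
        rw [← norm_iteratedFDeriv_fderiv, norm_iteratedFDeriv_zero]
      rw [e1,
        iteratedFDeriv_sub_apply (contDiff_infty.1 (hsmooth s' (hJI hs')) 1).contDiffAt
          (contDiff_infty.1 (hsmooth s (hJI hs)) 1).contDiffAt]
      exact hlip δ hδ0 1 s hs s' hs' z
    have hmv := (convex_univ (𝕜 := ℝ) (E := EuclideanSpace ℝ (Fin 3))).norm_image_sub_le_of_norm_fderiv_le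
      (fun z _ => hd.differentiableAt) (fun z _ => hbound z) (mem_univ y) (mem_univ x)
    calc ‖(U s' x - U s' y) - (U s x - U s y)‖ = ‖(U s' - U s) x - (U s' - U s) y‖ := by
          congr 1; simp only [Pi.sub_apply]; abel
      _ ≤ L 1 δ * |s' - s| * ‖x - y‖ := hmv
      _ = L 1 δ * ‖x - y‖ * |s' - s| := by ring
  have hu : ContinuousOn (fun s => u s x - u s y) (Ioo δ T) :=
    ((hline x).mono hJI).sub ((hline y).mono hJI)
  have hgood' : ∀ᵐ s ∂((volume : Measure ℝ).restrict (Ioo δ T)),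
      (U s x - U s y) - (u s x - u s y) = 0 :=
    (ae_restrict_of_ae_restrict_of_subset hJI hgood).mono fun s hs => hs x y
  have h := Measure.eqOn_open_of_ae_eq (f := fun s => (U s x - U s y) - (u s x - u s y))
    (g := fun _ => (0 : EuclideanSpace ℝ (Fin 3))) hgood' isOpen_Ioo (hU.sub hu) continuousOn_const hτJ
  exact sub_eq_zero.1 h

/-- **An Oseen-mild representative on a window** (the class bridge of the module docstring).
Let `v` be a bounded ancient mild solution (`ν = 1`, duality form) which is jointly continuous
on `(−∞, 0) × ℝ³`, and let `a < 0`. Then there are a field `W` on the window `(0, −a)`, a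
continuous path `B` and a bound `N` such that: `W` is jointly measurable, bounded by `N`, has
`C^∞` slices, solves the Oseen integral equation `W(t) = e^{(t−s)Δ}W(s) − B¹_s(W, W)(t)`
between all times `0 < s < t < −a`, and `v(τ + a, x) − v(τ + a, y) = W(τ, x − B τ) − W(τ, y − B τ)`
for EVERY `τ ∈ (0, −a)` and all `x, y` (KNSS 2009: Lemma 3.1 + §4 + the Galilean frame of §1).
[cite: KochNadirashviliSereginSverak2009, §1 p. 3, Lemma 3.1 (p. 7), §4 (4.3)–(4.4) (p. 8) (arXiv:0709.3599)] -/
theorem exists_oseen_repr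
    {v : ℝ → EuclideanSpace ℝ (Fin 3) → EuclideanSpace ℝ (Fin 3)}
    (hv : IsBoundedAncientMildSolution 1 v) (hcont : ContinuousOn (uncurry v) (Iio 0 ×ˢ univ))
    {a : ℝ} (ha : a < 0) :
    ∃ (W : ℝ → EuclideanSpace ℝ (Fin 3) → EuclideanSpace ℝ (Fin 3))
      (B : ℝ → EuclideanSpace ℝ (Fin 3)) (N : ℝ),
      Measurable (uncurry W) ∧
      (∀ τ ∈ Ioo 0 (-a), ∀ y, ‖W τ y‖ ≤ N) ∧
      (∀ τ ∈ Ioo 0 (-a), ContDiff ℝ ∞ (W τ)) ∧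
      (∀ s t : ℝ, 0 < s → s < t → t < -a → ∀ y,
        W t y = UnboundedOperators.heatExtension (W s) (t - s) y - oseenDuhamel 1 s W W t y) ∧
      (∀ τ ∈ Ioo 0 (-a), ∀ x y : EuclideanSpace ℝ (Fin 3),
        v (τ + a) x - v (τ + a) y = W τ (x - B τ) - W τ (y - B τ)) := by
  set T : ℝ := -a with hT
  have hT0 : 0 < T := by rw [hT]; linarith
  -- `v` is a bounded weak solution on `(−∞, 0)`
  have hmeas : AEStronglyMeasurable (uncurry v)
      ((volume : Measure (ℝ × EuclideanSpace ℝ (Fin 3))).restrict (Iio 0 ×ˢ univ)) :=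
    hcont.aestronglyMeasurable (measurableSet_Iio.prod MeasurableSet.univ)
  have hslc : ∀ t < 0, Continuous (v t) := fun t ht =>
    hcont.comp_continuous (Continuous.prodMk_right t) fun x => ⟨ht, mem_univ x⟩
  have hsl : ∀ t < 0, AEStronglyMeasurable (v t) volume := fun t ht =>
    (hslc t ht).aestronglyMeasurable
  have hweak : IsBoundedWeakNSSolutionOn (Iio 0) isOpen_Iio 1 v :=
    hv.isBoundedWeakNSSolutionOn one_pos hmeas hsl
  -- the shifted field on the window `(0, T)`
  have hu' : IsBoundedWeakNSSolutionOn (Ioo 0 T) isOpen_Ioo 1 (fun t => v (t + a)) := by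
    have h1 : IsBoundedWeakNSSolutionOn (Iio T) isOpen_Iio 1 (fun t => v (t + a)) :=
      hweak.comp_add_right a isOpen_Iio fun t => by
        simp only [mem_Iio, hT]
        constructor <;> intro h <;> linarith
    exact h1.mono isOpen_Ioo fun t ht => ht.2
  obtain ⟨M, hM⟩ := hv.2
  have hM' : ∀ t ∈ Ioo 0 T, ∀ x, ‖v (t + a) x‖ ≤ M := fun t ht x =>
    hM (t + a) (by simp only [mem_Iio]; rw [hT] at ht; linarith [ht.2]) x
  -- Lemma 3.1 in drift-mild form and §4 for the decomposed solution
  obtain ⟨N, hN⟩ := KNSS2009_weak_driftMild_holds M T hT0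
  obtain ⟨U, β, hUβ, hae⟩ := hN hu' hM'
  obtain ⟨C, L, hreg⟩ := KNSS2009_driftMild_regularity_holds N T hT0
  obtain ⟨hsmooth, -, -, hlip, -⟩ := hreg hUβ
  -- every-time identification on the window
  have hline : ∀ x, ContinuousOn (fun τ => v (τ + a) x) (Ioo 0 T) := by
    intro x
    have h1 : ContinuousOn (fun τ : ℝ => (τ + a, x)) (Ioo 0 T) :=
      ((continuous_id.add continuous_const).prodMk continuous_const).continuousOn
    exact hcont.comp h1 fun τ hτ => ⟨by
      simp only [mem_Iio]; rw [hT] at hτ; linarith [hτ.2], mem_univ _⟩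
  have hslice : ∀ τ ∈ Ioo 0 T, Continuous (v (τ + a)) := fun τ hτ =>
    hslc (τ + a) (by rw [hT] at hτ; linarith [hτ.2])
  have hident := repr_sub_eq_sub_of_ae_window hline hslice hae hsmooth hlip
  -- the Galilean frame: a zero-drift (Oseen-mild) field
  have hW : IsKNSSDriftMild T N (galileanShift U β) 0 := IsKNSSDriftMild.galileanCovariance_R3 hUβ
  refine ⟨galileanShift U β, driftPath β, N, hW.measurable, fun τ hτ y => hW.norm_le τ hτ y,
    fun τ hτ => ?_, fun s t hs hst ht y => ?_, fun τ hτ x y => ?_⟩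
  · -- smooth slices
    have h1 : ContDiff ℝ ∞ (fun y : EuclideanSpace ℝ (Fin 3) => y + driftPath β τ) :=
      contDiff_id.add contDiff_const
    exact (hsmooth τ hτ).comp h1
  · -- the Oseen integral equation
    have hmild := hW.mild s t hs hst ht y
    have hUm : ∀ σ ∈ Ioo s t, Measurable (galileanShift U β σ) := fun σ _ =>
      hW.measurable.of_uncurry_left
    have hNσ : ∀ σ ∈ Ioo s t, ∀ z, ‖galileanShift U β σ z + (0 : ℝ → EuclideanSpace ℝ (Fin 3)) σ‖ ≤ N :=
      fun σ hσ z => by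
        rw [Pi.zero_apply, add_zero]
        exact hW.norm_le σ ⟨hs.trans hσ.1, hσ.2.trans ht⟩ z
    rw [hmild, driftDuhamel_eq_oseenDuhamel_drift hUm hNσ hst.le y]
    simp only [Pi.zero_apply, add_zero]
  · -- identification with `v` at every time, back in the fixed frame
    rw [galileanShift_sub_driftPath, galileanShift_sub_driftPath]
    exact (hident τ hτ x y).symm

end UntwistedAncient

end Summit.NavierStokesRegularity.NavierStokesRegularity.Theorems

end
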